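import Summits.AtomisticToContinuum.BoseEinsteinCondensation.Theses.BECDispersionLadder

/-!
# Route BECDispersionLadder — item `LadderToTarget` (stmt-AtomisticToContinuum-14106)

The glue item of the kinetic-exponent ladder: the two dial cruxes `OpenSideBEC` (rung 1,
fixed-α condensation on the infrared-convergent side) and `DialUniformity` (rung 2, stated as
OpenSideBEC-body → Target-body with both bodies inlined) together give `Target`
(uniform dial condensation).  Pure logic: `DialUniformity` unfolds definitionally to
`OpenSideBEC → Target`.
-/

namespace Summit.AtomisticToContinuum.BoseEinsteinCondensation.Theorems

open Summit.AtomisticToContinuum.BoseEinsteinCondensation.Theses.BECDispersionLadder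

/-- Item `LadderToTarget` of route BECDispersionLadder (stmt-AtomisticToContinuum-14106):
`OpenSideBEC → DialUniformity → Target`.  Since `DialUniformity` is by definition the
implication from the body of `OpenSideBEC` to the body of `Target`, the item is closed by
modus ponens. -/
theorem ladderToTarget_proof :
    Summit.AtomisticToContinuum.BoseEinsteinCondensation.Theses.BECDispersionLadder.LadderToTarget := by
  unfold LadderToTarget
  intro h₁ h₂
  exact h₂ h₁

end Summit.AtomisticToContinuum.BoseEinsteinCondensation.Theorems
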